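import Literature.NumberTheory.GaloisRepresentations.LubinTateColemanCoordMomentsTwo
import Literature.NumberTheory.GaloisRepresentations.LubinTateColemanCoordFreeTwoVariable
import HarnessLib

/-!
# The moment functionals are EQUIVARIANT for the unit twists on the WHOLE coordinate module: `mom_k(σ_v r) = v^{k+1} · mom_k(r)` for every
# `r ∈ 𝒪_E⟦Y⟧` (`q = 2`) — `mom_k : M → 𝒪_E(χ^{k+1})` is a morphism of `𝒪_F^×`-modules (the specialisation of the Coleman module at weight `k+1`)

De Shalit, *Iwasawa theory of elliptic curves with complex multiplication* (1987), Ch. I §3.4 Lemma (ii), §3.5 (ii) ("`φ_k(γ(β)) = κ(γ)^k · φ_k(β)`");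
the sequel of `LubinTateColemanCoordMomentsTwo` (the functionals `mom_k(r) = [X⁰] D_E^[k]((1 + u⁻¹X)(r ∘ f))`, their values on the coordinates of the
units).  There the equivariance was proved on the image of `𝒰`; HERE on all of the coordinate module, for the twist operators
`σ_v = 1 + twistLinearBase ι u v` (`σ_v r = v · ι ρ_v · (r ∘ [v]_f)`, `LubinTateColemanCoordFreeTwoVariable`), `ι : 𝒪_F → 𝒪_E`:

* ★ `coordToKer_twist` — **`Φ(σ_v r) = v · (Φ r) ∘ [v]_f`** (from `(1 + u⁻¹X)(ι ρ_v ∘ f) = 1 + u⁻¹[v]_f` and `f ∘ [v] = [v] ∘ f`);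
* ★★ `coordMoment_twist` — **`mom_k(σ_v r) = v^{k+1} · mom_k(r)`** for all `r` (`[X⁰] D_E^[k](H ∘ [v]) = v^k [X⁰] D_E^[k] H`), and
  `coordMoment_twistLinearBase` (`mom_k(D_v r) = (v^{k+1} − 1)·mom_k(r)`): in the `Λ = 𝒪⟦T⟧`-module structure `T ↦ D_γ` the functional `mom_k`
  kills `(T − (γ^{k+1} − 1))M` on polynomial combinations — the weight-`(k+1)` SPECIALISATION of the Coleman module (continuity, proved in the
  prequel, extends it to all of `Λ`).

Everything PROVED (0 sorry).

## References
* E. de Shalit, *Iwasawa theory of elliptic curves with complex multiplication* (1987), Ch. I §3.4 Lemma (ii), §3.5 (ii). [deShalit1987]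
-/

noncomputable section

open PowerSeries

namespace Literature.NumberTheory.GaloisRepresentations

section CoordMomentsTwistTwo

open GaloisRepresentations.IsNonarchimedeanLocalField LubinTate ValuativeRel Field

variable {F : Type} [Field F] [ValuativeRel F] [TopologicalSpace F] [IsNonarchimedeanLocalField F]

attribute [local instance] ltNormUniformSpace ltNormIsUniformAddGroup rk1 nF nE fintypeResidueField

variable {π : 𝒪[F]} (hπ : (valuation F).IsUniformizer (π : F))
variable (E : IntermediateField F (AlgebraicClosure F)) [FiniteDimensional F E]
variable (hq : residueFieldCard F = 2) (u : (LTCoeff F)ˣ) (hu : LTCoeff.of F π = residueFieldCard F * u)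

/-- `[v]_f` read through `ι = algebraMap 𝒪_F 𝒪_E` is `homE` (unfolding). [cite: deShalit1987, Ch. I §1.5] -/
theorem map_hom_eq_homE (v : 𝒪[F]) :
    PowerSeries.map (algebraMap (LTCoeff F) (unitBall E))
        (hom (isLTRing_LTCoeff hπ) (isLTSeries_LTCoeff π) (isLTSeries_LTCoeff π) (LTCoeff.of F v)) = homE hπ E v := rfl

include hu in
/-- ★ **`Φ(σ_v r) = v · (Φ r) ∘ [v]_f`** for every `r ∈ 𝒪_E⟦Y⟧`, `σ_v r = r + D_v r = v·ιρ_v·(r ∘ [v]_f)`. [cite: deShalit1987, Ch. I §3.4 Lemma (ii)] -/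
theorem coordToKer_twist (v : 𝒪[F]ˣ) (r : PowerSeries (unitBall E)) :
    coordToKer hπ E u (twistLinearBase hπ hq (algebraMap (LTCoeff F) (unitBall E)) u v r + r) =
      PowerSeries.C (algebraMap 𝒪[F] (unitBall E) (v : 𝒪[F])) * PowerSeries.subst (homE hπ E (v : 𝒪[F])) (coordToKer hπ E u r) := by
  have ht := two_eq_of_mul_inv hq u hu
  have hsv := hasSubst_homE hπ E (v : 𝒪[F])
  have hsf : PowerSeries.HasSubst ((ltSer F π).map (algebraMap (LTCoeff F) (unitBall E))) := hasSubst_map_ltSer E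
  rw [twistLinearBase_apply, sub_add_cancel, map_hom_eq_homE hπ E, coordToKer, coordToKer, PowerSeries.subst_mul hsf, PowerSeries.subst_mul hsf,
    subst_map_ltSer_C, ← subst_homE_subst_map_ltSer hπ E, PowerSeries.subst_mul hsv, PowerSeries.subst_add hsv, PowerSeries.subst_mul hsv,
    subst_homE_C, PowerSeries.subst_X hsv, ← PowerSeries.coe_substAlgHom hsv, map_one, PowerSeries.coe_substAlgHom,
    ← one_add_mul_subst_map_evenPartTwo_unitTwistSerTwo hπ E hq ht v]
  have e : algebraMap (LTCoeff F) (unitBall E) (LTCoeff.of F (v : 𝒪[F])) = algebraMap 𝒪[F] (unitBall E) (v : 𝒪[F]) := rfl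
  rw [e]
  ring

include hu in
/-- ★★ **`mom_k(σ_v r) = v^{k+1} · mom_k(r)` for every `r`** — the moment functional is a morphism of `𝒪_F^×`-modules onto the character
`v ↦ v^{k+1}`. [cite: deShalit1987, Ch. I §3.4 Lemma (ii), §3.5 (ii)] -/
theorem coordMoment_twist (k : ℕ) (v : 𝒪[F]ˣ) (r : PowerSeries (unitBall E)) :
    coordMoment hπ E u k (twistLinearBase hπ hq (algebraMap (LTCoeff F) (unitBall E)) u v r + r) =
      algebraMap 𝒪[F] (unitBall E) (v : 𝒪[F]) ^ (k + 1) * coordMoment hπ E u k r := by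
  unfold coordMoment
  rw [coordToKer_twist hπ E hq u hu v r, iterate_derivation_C_mul, map_mul, PowerSeries.constantCoeff_C,
    constantCoeff_iterate_relDerivation_subst_homE, pow_succ]
  ring

include hu in
/-- **`mom_k(D_v r) = (v^{k+1} − 1) · mom_k(r)`** — on the twist `D_v = σ_v − 1` (the operator through which `T ∈ Λ = 𝒪⟦T⟧` acts for `v = γ`):
the functional `mom_k` specialises `T ↦ γ^{k+1} − 1`. [cite: deShalit1987, Ch. I §3.1, §3.5 (ii)] -/
theorem coordMoment_twistLinearBase (k : ℕ) (v : 𝒪[F]ˣ) (r : PowerSeries (unitBall E)) :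
    coordMoment hπ E u k (twistLinearBase hπ hq (algebraMap (LTCoeff F) (unitBall E)) u v r) =
      (algebraMap 𝒪[F] (unitBall E) (v : 𝒪[F]) ^ (k + 1) - 1) * coordMoment hπ E u k r := by
  have h := coordMoment_twist hπ E hq u hu k v r
  rw [coordMoment_add] at h
  rw [sub_mul, one_mul, ← h, add_sub_cancel_right]

include hu in
/-- **Iterates**: `mom_k(D_v^[n] r) = (v^{k+1} − 1)^n · mom_k(r)`, so `mom_k((p(T))·r) = p(γ^{k+1} − 1)·mom_k(r)` for every POLYNOMIAL `p` in the
`tAct`-structure `T ↦ D_γ`. [cite: deShalit1987, Ch. I §3.1] -/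
theorem coordMoment_twistLinearBase_iterate (k n : ℕ) (v : 𝒪[F]ˣ) (r : PowerSeries (unitBall E)) :
    coordMoment hπ E u k ((⇑(twistLinearBase hπ hq (algebraMap (LTCoeff F) (unitBall E)) u v))^[n] r) =
      (algebraMap 𝒪[F] (unitBall E) (v : 𝒪[F]) ^ (k + 1) - 1) ^ n * coordMoment hπ E u k r := by
  induction n generalizing r with
  | zero => rw [Function.iterate_zero_apply, pow_zero, one_mul]
  | succ n ih => rw [Function.iterate_succ_apply', coordMoment_twistLinearBase hπ E hq u hu, ih, pow_succ]; ring

end CoordMomentsTwistTwo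

end Literature.NumberTheory.GaloisRepresentations
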